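import Summits.BirchSwinnertonDyer.BirchSwinnertonDyer.Theorems.CyclotomicUntwistF1OfLattice
import Summits.BirchSwinnertonDyer.BirchSwinnertonDyer.Theorems.CyclotomicUntwistStabilisedTwistSymbol
import Summits.BirchSwinnertonDyer.BirchSwinnertonDyer.Theorems.CyclotomicUntwistGamma1RaySymbol
import Summits.BirchSwinnertonDyer.BirchSwinnertonDyer.Theorems.CyclotomicUntwistPinAdmissibleRoot
import Summits.BirchSwinnertonDyer.BirchSwinnertonDyer.Theorems.CyclotomicUntwistFiniteSlopeSeparatedPinnedLogNormPrint
import HarnessLib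

/-!
# F1′ — the untwisted `3`-adic `L`-function with the intrinsic root EXISTS — from ONE modular statement:
# the `α`-stabilised untwist of `f_W` is a weight-`2` cusp form on some `Γ₁(L)`; hence C1
# `PSUntwistedLFunctionAtThree` modulo print and that statement

Cell `pub/bsd-wall` (D-0145 line `route-BirchSwinnertonDyer-CyclotomicUntwist`), seat `bsd-line-cycu-p3`
(prover seat 3/3, gen 9). THEOREMS ONLY (no definition, no named fact, no `sorry`); helper toward the crux
child C1 = stmt-BirchSwinnertonDyer-27548 (`PSUntwistedLFunctionAtThree`). BSD is not proved by this file;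
C1 is NOT closed by it (it stays conditional on the modular statement (★) below and on print); K1/K2 stay
OPEN and WHOLE.

THE ASSEMBLY (this seat's files `CyclotomicUntwistF1OfLatticeGrowth` / `…F1OfLattice` / `…StabilisedTwistSymbol`
/ `…Gamma1RaySymbol`). Fix a coefficient field `K` with embeddings `ι_p : K →+* ℂ₃`, `ι_∞ : K →+* ℂ`
(e.g. `ℚ(ζ₃)`). For `W` with newform `f`, suppose
(★) there are a primitive `η_K` mod `9`, a root `α_K ∈ K` of `X² − a_w(W)X + 3`, a level `L`, a weight-`2`
cusp form `G` on `Γ₁(L)` and `κ ≠ 0` with `G(τ) − ι_∞(α_K)·G(3τ) = κ·∑_{u mod 9} ι_∞η_K(u) f(τ + u/9)` on `ℍ`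
— «the `α`-STABILISED UNTWIST is modular» (in truth: `G = g₀` the newform of `f ⊗ η̄` of level `9M`,
`U₃ g₀ = a₃(g₀) g₀`, `α_K = a₃(g₀)`, by Atkin–Li 1978 Thm. 3.1 and Carayol's local–global compatibility;
NOT proved here). Then:

* `exists_isPSCyclotomicLFunctionOf_of_stabilisedTwist` — `∃ 𝓛, IsPSCyclotomicLFunctionOf W (η_K∘ι_p) (ι_pα_K) 𝓛`:
  the ray symbols of `G` are integrable and lie in a finitely generated `ℤ`-module (Manin's trick,
  `PSGamma1RaySymbol`), their signed symmetrisation satisfies the `3`-deprivation identity in the rational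
  plus symbols of `f` (`PSStabilisedTwist`), so the `K`-valued Mazur–Tate–Teitelbaum candidate lies in a
  lattice and has growth `½` (`PSF1OfLattice`); the slope data `‖(ι_pα_K)⁻¹‖ = √3`, `α_K ∉ {0, 3}` come
  from the root equation (`CyclotomicUntwistPinAdmissibleRoot.norm_sq_of_root`).
* `hF1_of_stabilisedTwist` — F1′(a_w) on every principal-series row, in the exact shape of the hypothesis
  `hF1` of `CyclotomicUntwistFiniteSlopeSeparatedPinnedLogNormPrint.hEX'_of_print`, from (★) on every row
  and modularity (`nonempty_modularParametrizationData`, which supplies the newform).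
* `psUntwistedLFunctionAtThree_of_print_of_stabilisedTwist` — **C1 `PSUntwistedLFunctionAtThree` from PRINT
  (modularity, Carayol's level, GZ86 I.(7.3), GZK) and (★)**: the research residual F1′ of C1 is reduced to
  the single modular statement (★); no Shimura-1977 algebraicity, no Manin–Drinfeld for `Γ₁`, no `Γ₁`
  modular-symbol definition layer is used.

References: [cite: MazurTateTeitelbaum1986Invent, §I.10 and §I.14 (case p ∣ N, a_p ≠ 0)] ·
[cite: Bellaiche2021, Thm. 6.7.9] · [cite: Manin1972, §1.5–§1.6] · [cite: AtkinLi1978, Thm. 3.1] ·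
[cite: Carayol1986, Thm. (A)] · [cite: GrossZagier1986, Thm. I.(7.3)].
-/

noncomputable section

open scoped MatrixGroups

open CongruenceSubgroup UpperHalfPlane MeasureTheory Set
  Literature.NumberTheory.EllipticCurves Literature.NumberTheory.EllipticCurves.ModularForms
  Literature.NumberTheory.EllipticCurves.Rank1Residual Literature.NumberTheory.IwasawaTheory
  Summit.BirchSwinnertonDyer.BirchSwinnertonDyer.Theses.CyclotomicUntwist

-- single-conjunct summit: `Summit.BirchSwinnertonDyer.BirchSwinnertonDyer.…` repeats the name by design
set_option linter.dupNamespace false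
set_option autoImplicit false

namespace Summit.BirchSwinnertonDyer.BirchSwinnertonDyer.Theorems.PSF1OfStabilisedTwist

/-! ### §1 The intrinsic root: `α ≠ 0`, `α ≠ 3`, slope `½` -/

section Root

variable {a : ℤ}

/-- A root of `X² − aX + 3` with `3 ∣ a` is not `3` (else `a = 4`), in any field of characteristic `0`.
[folklore] -/
theorem root_ne_three {F : Type*} [Field F] [CharZero F] {α : F} (ha : (3 : ℤ) ∣ a)
    (h : α ^ 2 - (a : F) * α + 3 = 0) : α ≠ ((3 : ℕ) : F) := by
  rintro rfl
  obtain ⟨b, rfl⟩ := ha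
  have h' : ((12 - 9 * b : ℤ) : F) = 0 := by push_cast at h ⊢; linear_combination h
  have h12 : (12 - 9 * b : ℤ) = 0 := by exact_mod_cast h'
  omega

/-- **Slope `½`**: for a root `α ∈ ℂ₃` of `X² − aX + 3` with `3 ∣ a`, `‖α⁻¹‖ ≤ √3` (indeed `‖α‖² = ‖3‖₃`,
`CyclotomicUntwistPinAdmissibleRoot.norm_sq_of_root`). [cite: MazurTateTeitelbaum1986Invent, §I.14] -/
theorem norm_inv_root_le {α : ℂ_[3]} (ha : (3 : ℤ) ∣ a) (h : α ^ 2 - (a : ℂ_[3]) * α + 3 = 0) :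
    ‖α⁻¹‖ ≤ (3 : ℝ) ^ (1 / 2 : ℝ) := by
  have hsq := CyclotomicUntwistPinAdmissibleRoot.norm_sq_of_root ha h
  rw [CyclotomicUntwistFiniteSlopeSeparatedPinned.norm_nine.2] at hsq
  have h3 : ((3 : ℝ) ^ (1 / 2 : ℝ)) ^ 2 = 3 := by
    rw [← Real.rpow_natCast, ← Real.rpow_mul (by norm_num)]; norm_num
  have hspos : 0 < (3 : ℝ) ^ (1 / 2 : ℝ) := by positivity
  have hinv : ‖α⁻¹‖ ^ 2 = ((3 : ℝ) ^ (1 / 2 : ℝ)) ^ 2 := by rw [norm_inv, inv_pow, hsq, h3, inv_inv]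
  nlinarith [hinv, norm_nonneg α⁻¹, hspos]

end Root

/-! ### §2 D1 from the `α`-stabilised untwist (W-level) -/

section Main

variable {K : Type*} [Field K] (ιp : K →+* ℂ_[3]) (ι : K →+* ℂ)
variable {W : WeierstrassCurve ℚ} {N : ℕ} [NeZero N] {f : CuspForm (Gamma0 N) 2}
variable (ηK : DirichletCharacter K (3 ^ 2)) (αK : K)
variable {L : ℕ} [NeZero L] (G : CuspForm (Gamma1 L) 2) (κ : ℂ)
variable (hG : ∀ τ : ℍ, G τ - ι αK * G (ofComplex (((3 : ℕ) : ℂ) * (τ : ℂ))) =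
  κ * ∑ u : ZMod (3 ^ 2), ι (ηK u) * f ((((u.val : ℚ) / ((3 : ℕ) : ℚ) ^ 2 : ℚ) : ℝ) +ᵥ τ))

include hG in
/-- **D1 FROM THE `α`-STABILISED UNTWIST.** For the newform `f` of `W`, a coefficient field `K` with
`ι_p : K →+* ℂ₃`, `ι_∞ : K →+* ℂ`, a primitive `η_K` mod `9`, `α_K ≠ 0` with `‖(ι_pα_K)⁻¹‖ ≤ √3`,
`ι_pα_K ≠ 3`, `ι_∞α_K ≠ 3`, and a weight-`2` cusp form `G` on `Γ₁(L)` with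
`G − ι_∞(α_K)·G(3·) = κ·∑_u ι_∞η_K(u) f(· + u/9)`, `κ ≠ 0`:
`∃ 𝓛, IsPSCyclotomicLFunctionOf W (η_K ∘ ι_p) (ι_p α_K) 𝓛`. [cite: MazurTateTeitelbaum1986Invent, §I.14 (case p ∣ N, a_p ≠ 0)]
[cite: Manin1972, §1.5–§1.6] [cite: Bellaiche2021, Thm. 6.7.9] -/
theorem exists_isPSCyclotomicLFunctionOf_of_stabilisedTwist (hf : IsNewformOf W f) (hη : ηK.IsPrimitive)
    (hαK : αK ≠ 0) (hαn : ‖(ιp αK)⁻¹‖ ≤ (3 : ℝ) ^ (1 / 2 : ℝ)) (hαp : ιp αK ≠ (3 : ℕ))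
    (hα : ι αK ≠ (3 : ℕ)) (hκ : κ ≠ 0) :
    ∃ 𝓛 : (n : ℕ) → ZMod (3 ^ n) → ℂ_[3], IsPSCyclotomicLFunctionOf W (ηK.ringHomComp ιp) (ιp αK) 𝓛 := by
  classical
  -- the ray symbol of `G`, its signed symmetrisation
  set ΨG : ℚ → ℂ := fun r ↦ 2 * Real.pi * ∫ t in Ioi (0 : ℝ), G (ofComplex ((r : ℂ) + t * Complex.I))
    with hΨG
  set Ψ : ℚ → ℂ := fun r ↦ (ΨG r + (ηK.ringHomComp ι) (-1) * ΨG (-r)) / (2 * κ * (plusPeriod f : ℂ))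
    with hΨ
  have hG' : ∀ τ : ℍ, G τ - ι αK * G (ofComplex (((3 : ℕ) : ℂ) * (τ : ℂ))) =
      κ * ∑ u : ZMod (3 ^ 2), (ηK.ringHomComp ι) u *
        f ((((u.val : ℚ) / ((3 : ℕ) : ℚ) ^ 2 : ℚ) : ℝ) +ᵥ τ) := by
    simpa only [MulChar.ringHomComp_apply] using hG
  have hGint := PSGamma1RaySymbol.integrableOn_raySymbol_integrand G
  -- (C-i) periodicity, (C-ii) the deprivation identity
  have hΨper : ∀ (r : ℚ) (n : ℤ), Ψ (r + n) = Ψ r :=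
    PSStabilisedTwist.psi_add_intCast f (ηK.ringHomComp ι) κ G ΨG (fun _ ↦ rfl) Ψ (fun _ ↦ rfl)
  have hΨrec : ∀ r : ℚ, Ψ r - ι αK / (3 : ℕ) * Ψ ((3 : ℕ) * r) =
      ∑ b : ZMod (3 ^ 2), ι (ηK b) *
        ((ratPlusSymbol f (r + (b.val : ℚ) / ((3 : ℕ) : ℚ) ^ 2) : ℚ) : ℂ) := by
    intro r
    have h := PSStabilisedTwist.psi_sub_eq_sum_ratPlusSymbol (p := 3) f (ηK.ringHomComp ι) (ι αK) κ G hG'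
      hGint ΨG (fun _ ↦ rfl) Ψ (fun _ ↦ rfl) hf.1 hf.coeffField_eq_bot hκ r
    simpa only [MulChar.ringHomComp_apply] using h
  -- (C-iii) the lattice
  obtain ⟨ΛG, hΛG, hmemG⟩ := PSGamma1RaySymbol.exists_fg_forall_raySymbol_mem G
  obtain ⟨Λ, hΛ, hmem⟩ := PSStabilisedTwist.exists_fg_forall_psi_mem f (ηK.ringHomComp ι) κ ΨG Ψ
    (fun _ ↦ rfl) hΛG hmemG
  exact PSF1OfLattice.exists_isPSCyclotomicLFunctionOf_of_lattice ιp ι ηK αK Ψ hΨper hΨrec hf hη hαK hαn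
    hαp hα hΛ (fun M a ↦ hmem _)

include ιp hG in
/-- **F1′ at one `W` from the `α`-stabilised untwist, the root being INTRINSIC**: if `α_K` is a root of
`X² − a_w(W)X + 3` then all slope data are automatic and
`∃ η α 𝓛, η.IsPrimitive ∧ α² − a_w(W)α + 3 = 0 ∧ IsPSCyclotomicLFunctionOf W η α 𝓛`
(`η = η_K ∘ ι_p`, `α = ι_p α_K`). [cite: MazurTateTeitelbaum1986Invent, §I.14] -/
theorem exists_intrinsic_of_stabilisedTwist (hf : IsNewformOf W f) (hη : ηK.IsPrimitive)
    (hroot : αK ^ 2 - ((W.psUntwistedTrace : ℤ) : K) * αK + 3 = 0) (hκ : κ ≠ 0) :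
    ∃ (η : DirichletCharacter ℂ_[3] (3 ^ 2)) (α : ℂ_[3]) (𝓛 : (n : ℕ) → ZMod (3 ^ n) → ℂ_[3]),
      η.IsPrimitive ∧ α ^ 2 - ((W.psUntwistedTrace : ℤ) : ℂ_[3]) * α + 3 = 0 ∧
        IsPSCyclotomicLFunctionOf W η α 𝓛 := by
  haveI : CharZero K := ι.charZero
  have h3 := PSUntwistedTrace.three_dvd_psUntwistedTrace W
  have hrootp : (ιp αK) ^ 2 - ((W.psUntwistedTrace : ℤ) : ℂ_[3]) * ιp αK + 3 = 0 := by
    have := congrArg ιp hroot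
    simpa only [map_sub, map_add, map_mul, map_pow, map_intCast, map_ofNat, map_zero] using this
  have hrootC : (ι αK) ^ 2 - ((W.psUntwistedTrace : ℤ) : ℂ) * ι αK + 3 = 0 := by
    have := congrArg ι hroot
    simpa only [map_sub, map_add, map_mul, map_pow, map_intCast, map_ofNat, map_zero] using this
  obtain ⟨𝓛, h𝓛⟩ := exists_isPSCyclotomicLFunctionOf_of_stabilisedTwist ιp ι ηK αK G κ hG hf hη
    (CyclotomicUntwistPinAdmissibleRoot.root_ne_zero (by norm_num) hroot) (norm_inv_root_le h3 hrootp)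
    (root_ne_three h3 hrootp) (root_ne_three h3 hrootC) hκ
  exact ⟨ηK.ringHomComp ιp, ιp αK, 𝓛, (Literature.NumberTheory.EllipticCurves.isPrimitive_ringHomComp_iff ιp ηK).mpr hη,
    hrootp, h𝓛⟩

end Main

/-! ### §3 C1 `PSUntwistedLFunctionAtThree` modulo print and the modular statement (★) -/

section C1

variable {K : Type*} [Field K] (ιp : K →+* ℂ_[3]) (ι : K →+* ℂ)

include ιp in
/-- **F1′ ON EVERY PRINCIPAL-SERIES ROW from (★) on every row**, in the exact shape of the hypothesis `hF1`
of `CyclotomicUntwistFiniteSlopeSeparatedPinnedLogNormPrint.hEX'_of_print` (`aw := psUntwistedTrace`):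
modularity (`nonempty_modularParametrizationData`) supplies the newform `f` of `W`; (★) supplies, for that
`f`, the primitive `η_K`, the intrinsic root `α_K` and the `α_K`-stabilised untwist `G` on some `Γ₁(L)`.
[cite: MazurTateTeitelbaum1986Invent, §I.14] [cite: AtkinLi1978, Thm. 3.1] [cite: BCDTJAMS2001, Thm. A] -/
theorem hF1_of_stabilisedTwist (hmod : nonempty_modularParametrizationData)
    (hStab : ∀ (W : WeierstrassCurve ℚ) [W.IsElliptic] [W.IsGloballyMinimal], ¬ W.HasCM →
      Summit.BirchSwinnertonDyer.Rank1Residual.Additive.ClassO6 W 3 → Surj W 3 →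
      Even (padicValInt 3 W.minimalDiscriminantInt) →
      W.minimalDiscriminantInt / 3 ^ padicValInt 3 W.minimalDiscriminantInt % 3 = 1 →
      W.analyticRank = 1 →
      ∀ {N : ℕ} [NeZero N] (f : CuspForm (Gamma0 N) 2), IsNewformOf W f →
      ∃ (ηK : DirichletCharacter K (3 ^ 2)) (αK : K) (L : ℕ) (_ : NeZero L) (G : CuspForm (Gamma1 L) 2) (κ : ℂ),
        ηK.IsPrimitive ∧ αK ^ 2 - ((W.psUntwistedTrace : ℤ) : K) * αK + 3 = 0 ∧ κ ≠ 0 ∧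
        ∀ τ : ℍ, G τ - ι αK * G (ofComplex (((3 : ℕ) : ℂ) * (τ : ℂ))) =
          κ * ∑ u : ZMod (3 ^ 2), ι (ηK u) * f ((((u.val : ℚ) / ((3 : ℕ) : ℚ) ^ 2 : ℚ) : ℝ) +ᵥ τ))
    (W : WeierstrassCurve ℚ) [W.IsElliptic] [W.IsGloballyMinimal] (hCM : ¬ W.HasCM)
    (hO6 : Summit.BirchSwinnertonDyer.Rank1Residual.Additive.ClassO6 W 3) (hsurj : Surj W 3)
    (hev : Even (padicValInt 3 W.minimalDiscriminantInt))
    (hsq : W.minimalDiscriminantInt / 3 ^ padicValInt 3 W.minimalDiscriminantInt % 3 = 1)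
    (hr : W.analyticRank = 1) :
    ∃ (η : DirichletCharacter ℂ_[3] (3 ^ 2)) (α : ℂ_[3]) (𝓛 : (n : ℕ) → ZMod (3 ^ n) → ℂ_[3]),
      η.IsPrimitive ∧ α ^ 2 - ((W.psUntwistedTrace : ℤ) : ℂ_[3]) * α + 3 = 0 ∧
        IsPSCyclotomicLFunctionOf W η α 𝓛 := by
  haveI : NeZero (W.conductorNorm ℤ) := ⟨(W.conductorNorm_pos_holds).ne'⟩
  obtain ⟨Dm⟩ := hmod W
  obtain ⟨ηK, αK, L, _, G, κ, hη, hroot, hκ, hG⟩ := hStab W hCM hO6 hsurj hev hsq hr Dm.f Dm.isNewformOf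
  exact exists_intrinsic_of_stabilisedTwist ιp ι ηK αK G κ hG Dm.isNewformOf hη hroot hκ

include ιp in
/-- **C1 `PSUntwistedLFunctionAtThree` FROM PRINT AND (★).** PRINT = modularity
(`nonempty_modularParametrizationData`), Carayol's «level = conductor» (`IsNewformOf.level_eq_conductorNorm`),
Gross–Zagier I.(7.3) (`GrossZagier1986_thm_I_7_3`), Gross–Zagier–Kolyvagin (`PublishedInputGZK`).
(★) = on every principal-series row, the `α`-stabilised untwist of the newform `f_W` (`α` a root of
`X² − a_w(W)X + 3` in a fixed coefficient field `K ↪ ℂ₃, ℂ`, `η` primitive mod `9`) is a weight-`2` cusp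
form on some `Γ₁(L)`:  `G − ι_∞(α)·G(3·) = κ·∑_u ι_∞η(u) f_W(· + u/9)`, `κ ≠ 0` — in print the newform `g₀`
of `f_W ⊗ η̄` of level `9M` with `U₃ g₀ = a₃(g₀) g₀` (Atkin–Li 1978 Thm. 3.1; `a₃(g₀)² − a_w a₃(g₀) + 3 = 0`
by Carayol 1986 and Néron–Ogg–Shafarevich over `ℚ₃(ζ₉)`). The conclusion is the crux child C1 VERBATIM
(`Theses.CyclotomicUntwist.PSUntwistedLFunctionAtThree`), via cycu-p5's `hEX'_of_print`.
[cite: MazurTateTeitelbaum1986Invent, §I.14] [cite: AtkinLi1978, Thm. 3.1] [cite: Carayol1986, Thm. (A)]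
[cite: GrossZagier1986, Thm. I.(7.3)] [cite: BCDTJAMS2001, Thm. A] -/
theorem psUntwistedLFunctionAtThree_of_print_of_stabilisedTwist (hmod : nonempty_modularParametrizationData)
    (hlev : ∀ (N : ℕ) [NeZero N], IsNewformOf.level_eq_conductorNorm (N := N))
    (hGZ86 : GrossZagier1986_thm_I_7_3) (hGZK : PublishedInputGZK)
    (hStab : ∀ (W : WeierstrassCurve ℚ) [W.IsElliptic] [W.IsGloballyMinimal], ¬ W.HasCM →
      Summit.BirchSwinnertonDyer.Rank1Residual.Additive.ClassO6 W 3 → Surj W 3 →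
      Even (padicValInt 3 W.minimalDiscriminantInt) →
      W.minimalDiscriminantInt / 3 ^ padicValInt 3 W.minimalDiscriminantInt % 3 = 1 →
      W.analyticRank = 1 →
      ∀ {N : ℕ} [NeZero N] (f : CuspForm (Gamma0 N) 2), IsNewformOf W f →
      ∃ (ηK : DirichletCharacter K (3 ^ 2)) (αK : K) (L : ℕ) (_ : NeZero L) (G : CuspForm (Gamma1 L) 2) (κ : ℂ),
        ηK.IsPrimitive ∧ αK ^ 2 - ((W.psUntwistedTrace : ℤ) : K) * αK + 3 = 0 ∧ κ ≠ 0 ∧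
        ∀ τ : ℍ, G τ - ι αK * G (ofComplex (((3 : ℕ) : ℂ) * (τ : ℂ))) =
          κ * ∑ u : ZMod (3 ^ 2), ι (ηK u) * f ((((u.val : ℚ) / ((3 : ℕ) : ℚ) ^ 2 : ℚ) : ℝ) +ᵥ τ)) :
    PSUntwistedLFunctionAtThree := by
  intro W _ _ hCM hO6 hsurj hev hsq hr
  exact CyclotomicUntwistFiniteSlopeSeparatedPinnedLogNormPrint.hEX'_of_print (fun V ↦ V.psUntwistedTrace)
    hmod hlev hGZ86 hGZK
    (fun V _ _ hCM' hO6' hsurj' hev' hsq' hr' ↦ hF1_of_stabilisedTwist ιp ι hmod hStab V hCM' hO6' hsurj' hev' hsq' hr')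
    W hCM hO6 hsurj hev hsq hr

end C1

end Summit.BirchSwinnertonDyer.BirchSwinnertonDyer.Theorems.PSF1OfStabilisedTwist

end
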